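import Literature.NumberTheory.EllipticCurves.ZpExtensionEisensteinDVRSettingH4KernelTwistProofs
import Literature.NumberTheory.EllipticCurves.ZpExtensionEisensteinDVRSettingH4AdjointMirrorProofs
import Literature.NumberTheory.EllipticCurves.ZpExtensionEisensteinDVRSettingH4PerfectProofs
import Literature.NumberTheory.EllipticCurves.ZpExtensionEisensteinDVRSettingH4PerfectLeftProofs
import Literature.NumberTheory.EllipticCurves.ZpExtensionEisensteinDVRSettingH4TowerPairingProofs
import Literature.NumberTheory.EllipticCurves.ZpExtensionEisensteinDVRSettingH4UnramifiedProofs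
import Literature.NumberTheory.EllipticCurves.TowerTorsionAnnihilatorProofs
import Literature.NumberTheory.GaloisCohomology.Howard2004.UnramifiedIsotropy
import Literature.NumberTheory.GaloisRepresentations.LocalGlobalCohomologyFiniteProofs
import HarnessLib

/-!
# Howard's H.4 for the curve's Eisenstein setting AT THE BAD PLACES `v ∈ S`, `v ∤ p`: `F_𝔮` (the saturated unramified condition)
# is its own exact orthogonal complement, given the uniform local torsion bound (theorems only)

`Proofs` file (theorems only; no definition, no named fact, no instance, no `sorry`).  Topic `NumberTheory/EllipticCurves`
(D1 road of cell `pub/bsd-print-x9`, LEAD `bsd-line-x10b-p1` g8: the (GLUE-N) assembly of the `hfin4` clause of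
`eisensteinDVRSettingLevelsTame_satisfiesH_of_ofLifts` (p658714) / `Stmt.h4AtS` at the places `v ∈ S ∖ {v ∣ p}`).

For `T := W.eisensteinTower κ hm` (`T^{(k)} = E_K[p^{k+1}] ⊗ A_{m,k+1}(ψ)`), H.4 data `D` with `he_red`, a conjugation datum `cd`
with inertia-compatible transport at `v`, the Poitou–Tate named fact, and a place `v ∈ S` with `p ∉ v`, `σ•v ∈ S`, `p ∉ σ•v`
such that the local towers `H¹(K_v, T^{(j)})` and `H¹(K_v, Tw T^{(j)})` are UNIFORMLY TORSION (`p^c` kills every level — x9-p1-w4's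
(N1) `exists_forall_pow_smul_galoisCohomology_one_toLocal_eq_zero_uniform` at `v ∣ N`, `m > 2N_v`), the local condition
`F_𝔮 = (W.eisensteinTowerTriple … k).cond` satisfies `(D k).IsSelfOrthogonalAt F_𝔮 v` — by w8's TORSION DESCENT
`Tower.levelCondition_mem_iff_forall_pairing_eq_zero_of_forall_nsmul_eq_zero` (p650903) fed with: (hB)/(hQ) x9-p1-w2 g7
`eisensteinTower_localCup_towerCompat` (p660339); (hC) `DualityDatum.localCup_transportH1_eq_zero_of_mem_unramifiedSubgroup`;
(Dual, Y-side) w4's `Tower.mem_levelCondition_top_of_forall_pairing_bot_eq_zero_of_range` (p659369) with (Perf)/(Nondeg)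
`eisensteinTower_localCup_towerDuality` (p660780), (Adj) `eisensteinTower_exists_incQ_localCup_towerAdjoint` (p662398) and (Ker)
`eisensteinTower_ker_map_transfer_le_levelCondition_bot'` (p662207); (Dual, X-side) the same lemma for the FLIPPED pairing with
(Adj-mirror) `eisensteinTower_exists_incQ_localCup_towerAdjoint_left` (p662903), (Nondeg, right) `eisensteinTower_localCup_nondegenerate`,
(Ker-Y) `eisensteinTower_ker_map_twist_transfer_le_levelCondition_bot` (p666061) and the `X`-side (Perf)
`eisensteinTower_localCup_towerDuality_left` (x9-p1-w2 g8's (M1), p665518); identifications `F_𝔮(v) = levelCondition` (`eisensteinSelmerStructure_inr_of_mem_of_not_mem` +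
`levelCondition_eisensteinLocalReduce_succ`) and `Fbar = levelCondition` of the twisted tower (x9-p1-w4 g6's (F̄)
`eisensteinTowerTriple_cond_map_transportH1_eq_of_mem_of_not_mem`, p663435, + the twisted index shift).

* **`WeierstrassCurve.eisensteinTower_isSelfOrthogonalAt_of_mem_of_not_mem`** (any `cd`, inertia-compatible at `v`);
* **`WeierstrassCurve.eisensteinTower_isSelfOrthogonalAt_of_mem_of_not_mem_ofLifts`** (canonical `cd`; torsion bounds at `v` and `σ•v`).
HONEST FRAMING: conditional on `poitouTate_selmerStructure_duality K`; `hTX`, `hTY` (the (N1) uniform torsion) are hypotheses.  No summit statement is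
proved; BSD is not proved by any of this.

References: B. Howard, Compositio Math. 140 (2004), §1.3 H.4, §1.6, Def. 3.1.2, Def. 3.2.6 (arXiv:1202.6340 p. 7 L69–82, p. 11–12,
p. 15–16); J. S. Milne, *Arithmetic Duality Theorems* (2006), I Cor. 2.3, Thm. 2.6; B. Mazur, K. Rubin, Mem. AMS 799 (2004), §1.3.
-/

set_option autoImplicit false

noncomputable section

open Function NumberField IsDedekindDomain Field CategoryTheory
open scoped NumberField ContRepresentation TensorProduct Classical

namespace WeierstrassCurve

open Literature.NumberTheory.EllipticCurves Literature.NumberTheory.GaloisRepresentations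
open Literature.NumberTheory.GaloisRepresentations.DiscreteGaloisModule
open Literature.NumberTheory.GaloisCohomology Literature.NumberTheory.GaloisCohomology.Howard2004
open Literature.NumberTheory.EllipticCurves.ZpExtension (EisensteinLevel)

variable {K : Type} [Field K] [NumberField K] (W : WeierstrassCurve ℚ) [W.IsElliptic] {p : ℕ} [hp : Fact p.Prime]
  (κ : ZpExtension K p) {m : ℕ} (hm : 1 ≤ m)
  (S : Finset (HeightOneSpectrum (𝓞 K)))
  (hpS : ∀ v : HeightOneSpectrum (𝓞 K), ((p : ℕ) : 𝓞 K) ∈ v.asIdeal → v ∈ S)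
  (hbad : ∀ v : HeightOneSpectrum (𝓞 K), v ∉ S → ((p : ℕ) : 𝓞 K) ∉ v.asIdeal → (W.baseChange K).HasGoodReductionAt v)
  (L : Set (HeightOneSpectrum (𝓞 K)))
  (hL : letI := IwasawaAlgebra.isLocalRing_quotient_X_pow_add_C p hm
    L ⊆ (W.eisensteinTower κ hm).degreeTwoPrimes p)
  (hLS : ∀ v ∈ L, v ∉ S)
  (cd : ConjugationDatum K)
  (D : letI := IwasawaAlgebra.isLocalRing_quotient_X_pow_add_C p hm
    ∀ k, DualityDatum p cd ((W.eisensteinTower κ hm).ρ k) (IwasawaAlgebra.EisensteinCoeff p m (k + 1)))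


set_option maxHeartbeats 400000 in
/-- **H.4 at a bad place `v ∈ S`, `v ∤ p`, for the curve's Eisenstein setting.**  With `T := W.eisensteinTower κ hm`, H.4 data `D`
satisfying `he_red`, the Poitou–Tate named fact, a conjugation datum whose transport at `v` matches inertia, `v, σ•v ∈ S` prime to `p`,
the local towers at `v` (plain and twisted) killed by `p^c`:
the saturated unramified condition `F_𝔮 = (W.eisensteinTowerTriple … k).cond` is its own exact orthogonal complement at `v` under the
induced local pairing of `D k` — `(D k).IsSelfOrthogonalAt F_𝔮 v`, the `v`-clause of `hfin4`.
[cite: Howard2004HeegnerKolyvagin, §1.3 H.4, Def. 3.1.2 and Def. 3.2.6 (arXiv p. 7 L78–82, p. 15–16)] [cite: MilneADT2006, Ch. I, Cor. 2.3 and Thm. 2.6] -/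
theorem eisensteinTower_isSelfOrthogonalAt_of_mem_of_not_mem
    (he_red : letI := IwasawaAlgebra.isLocalRing_quotient_X_pow_add_C p hm
      ∀ k (x y : EisensteinLevel p m (fun j ↦ geomTorsion (W.baseChange K) ((p : ℤ) ^ j)) (k + 1 + 1)),
        IwasawaAlgebra.EisensteinCoeff.reduce p m (Nat.le_succ (k + 1)) ((D (k + 1)).e x y) =
          (D k).e ((W.eisensteinTower κ hm).red k x) ((W.eisensteinTower κ hm).red k y))
    (hPT : poitouTate_selmerStructure_duality K) (k : ℕ)
    {v : HeightOneSpectrum (𝓞 K)} (hv : ((p : ℕ) : 𝓞 K) ∉ v.asIdeal) (hvS : v ∈ S)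
    (hσv : ((p : ℕ) : 𝓞 K) ∉ (cd.σ • v).asIdeal) (hσvS : cd.σ • v ∈ S)
    (hI : ∀ g ∈ absInertia (v.adicCompletion K), cd.φ v g ∈ absInertia ((cd.σ • v).adicCompletion K))
    {c : ℕ}
    (hTX : letI := IwasawaAlgebra.isLocalRing_quotient_X_pow_add_C p hm
      ∀ (j : ℕ) (x : galoisCohomology (((W.eisensteinTower κ hm).ρ j).toLocal (Sum.inr v)) 1), p ^ c • x = 0)
    (hTY : letI := IwasawaAlgebra.isLocalRing_quotient_X_pow_add_C p hm
      ∀ (j : ℕ) (y : galoisCohomology ((cd.twist ((W.eisensteinTower κ hm).ρ j)).toLocal (Sum.inr v)) 1), p ^ c • y = 0) :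
    letI := IwasawaAlgebra.isLocalRing_quotient_X_pow_add_C p hm
    (D k).IsSelfOrthogonalAt (W.eisensteinTowerTriple κ hm S hpS hbad L hL hLS k).cond v := by
  letI := IwasawaAlgebra.isLocalRing_quotient_X_pow_add_C p hm
  have hpp := hp.out
  have hpK : (p : K) ≠ 0 := by exact_mod_cast hpp.ne_zero
  -- finiteness of the levels and of the local `H¹`'s
  haveI hfinM : ∀ j, Finite (EisensteinLevel p m (fun j ↦ geomTorsion (W.baseChange K) ((p : ℤ) ^ j)) (j + 1)) := fun j ↦ by
    haveI : Finite (geomTorsion (W.baseChange K) ((p : ℤ) ^ (j + 1))) :=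
      finite_torsionPoints_holds (W.baseChange K) (AlgebraicClosure K) (n := (p : ℤ) ^ (j + 1))
        (pow_ne_zero _ (by exact_mod_cast hpp.ne_zero))
    exact IwasawaAlgebra.EisensteinCoeff.finite_twisted (p := p) (k := j + 1)
      (M := geomTorsion (W.baseChange K) ((p : ℤ) ^ (j + 1))) hm
  haveI : ∀ j, Finite (galoisCohomology ((cd.twist ((W.eisensteinTower κ hm).ρ j)).toLocal (Sum.inr v)) 1) := fun j ↦
    finite_galoisCohomology_one_toLocal _ v
  haveI : ∀ j, Finite (galoisCohomology (((W.eisensteinTower κ hm).ρ j).toLocal (Sum.inr v)) 1) := fun j ↦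
    finite_galoisCohomology_one_toLocal _ v
  -- the level rings are `p`-primary
  have hR : ∀ j, IsPrimaryTorsion p (IwasawaAlgebra.EisensteinCoeff p m (j + 1)) := fun j ↦
    IsPrimaryTorsion.of_forall_nsmul_eq_zero (r := j + 1) fun r ↦ by
      haveI := IwasawaAlgebra.EisensteinCoeff.charP p hm (j + 1)
      have h0 : ((p ^ (j + 1) : ℕ) : IwasawaAlgebra.EisensteinCoeff p m (j + 1)) = 0 := CharP.cast_eq_zero _ _
      rw [nsmul_eq_mul, h0, zero_mul]
  -- (hB), (hQ)
  obtain ⟨hB, hQ, -, -⟩ := W.eisensteinTower_localCup_towerCompat κ hm cd D he_red hPT v k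
  -- (Dual), `Y`-side
  obtain ⟨incQ, hAdj⟩ := W.eisensteinTower_exists_incQ_localCup_towerAdjoint κ hm cd D he_red (Sum.inr v) k
  obtain ⟨hPerf, hNondeg⟩ := W.eisensteinTower_localCup_towerDuality κ hm cd D hPT v k
  have hDualY := Tower.mem_levelCondition_top_of_forall_pairing_bot_eq_zero_of_range
    (X := fun j ↦ galoisCohomology (((W.eisensteinTower κ hm).ρ j).toLocal (Sum.inr v)) 1)
    (Y := fun j ↦ galoisCohomology ((cd.twist ((W.eisensteinTower κ hm).ρ j)).toLocal (Sum.inr v)) 1)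
    (Q := fun j ↦ galoisCohomology ((D j).twistOne.toLocal (Sum.inr v)) 2)
    (fun j ↦ ContinuousRep.cohomologyMap (((W.eisensteinTower κ hm).ρ (j + 1)).toLocal (Sum.inr v))
      (((W.eisensteinTower κ hm).ρ j).toLocal (Sum.inr v)) ((W.eisensteinTower κ hm).red j).toAddMonoidHom
      continuous_of_discreteTopology (fun _ z => (W.eisensteinTower κ hm).red_equivariant j _ z) 1)
    (fun j ↦ ContinuousRep.cohomologyMap ((cd.twist ((W.eisensteinTower κ hm).ρ (j + 1))).toLocal (Sum.inr v))
      ((cd.twist ((W.eisensteinTower κ hm).ρ j)).toLocal (Sum.inr v)) ((W.eisensteinTower κ hm).red j).toAddMonoidHom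
      continuous_of_discreteTopology (fun _ z => (W.eisensteinTower κ hm).red_equivariant j _ z) 1)
    (fun j ↦ (D j).localCup (Sum.inr v)) p k
    (fun d ↦ galoisCohomology.map (Literature.NumberTheory.EllipticCurves.DiscreteGaloisModule.localMap
      ((W.baseChange K).eisensteinTwistTorsionTransfer κ hm (fun j ↦ (W.baseChange K).torsionGaloisModuleReduce p j)
        (W.torsionGaloisModuleReduce_coe (K := K) (p := p)) (k + 1) (k + d + 1)) (Sum.inr v)) 1)
    incQ hPerf hAdj hNondeg
    (fun d x hx ↦ W.eisensteinTower_ker_map_transfer_le_levelCondition_bot' κ hm v k d ((AddMonoidHom.mem_ker).2 hx))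
  -- (Dual), `X`-side (flipped pairing)
  obtain ⟨incQ', hAdj'⟩ := W.eisensteinTower_exists_incQ_localCup_towerAdjoint_left κ hm cd D he_red (Sum.inr v) k
  obtain ⟨hPerfL, -⟩ := W.eisensteinTower_localCup_towerDuality_left κ hm cd D hPT v k
  have hNondeg' : ∀ (d : ℕ) (y : galoisCohomology ((cd.twist ((W.eisensteinTower κ hm).ρ (k + d))).toLocal (Sum.inr v)) 1),
      (∀ x : galoisCohomology (((W.eisensteinTower κ hm).ρ (k + d)).toLocal (Sum.inr v)) 1,
        ((D (k + d)).localCup (Sum.inr v)).flip y x = 0) → y = 0 :=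
    fun d y hy ↦ (W.eisensteinTower_localCup_nondegenerate κ hm cd D hPT (k + d) v).2 y fun x ↦ hy x
  have hPerfL' : ∀ (d : ℕ) (x : galoisCohomology (((W.eisensteinTower κ hm).ρ k).toLocal (Sum.inr v)) 1),
      (∀ y : galoisCohomology ((cd.twist ((W.eisensteinTower κ hm).ρ k)).toLocal (Sum.inr v)) 1,
        (∀ t ∈ (Tower.redIter (H := fun j ↦ galoisCohomology (((W.eisensteinTower κ hm).ρ j).toLocal (Sum.inr v)) 1)
            (fun j ↦ ContinuousRep.cohomologyMap (((W.eisensteinTower κ hm).ρ (j + 1)).toLocal (Sum.inr v))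
              (((W.eisensteinTower κ hm).ρ j).toLocal (Sum.inr v)) ((W.eisensteinTower κ hm).red j).toAddMonoidHom
              continuous_of_discreteTopology (fun _ z => (W.eisensteinTower κ hm).red_equivariant j _ z) 1) k d).range,
          ((D k).localCup (Sum.inr v)).flip y t = 0) → ((D k).localCup (Sum.inr v)).flip y x = 0) →
      x ∈ (Tower.redIter (H := fun j ↦ galoisCohomology (((W.eisensteinTower κ hm).ρ j).toLocal (Sum.inr v)) 1)
        (fun j ↦ ContinuousRep.cohomologyMap (((W.eisensteinTower κ hm).ρ (j + 1)).toLocal (Sum.inr v))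
          (((W.eisensteinTower κ hm).ρ j).toLocal (Sum.inr v)) ((W.eisensteinTower κ hm).red j).toAddMonoidHom
          continuous_of_discreteTopology (fun _ z => (W.eisensteinTower κ hm).red_equivariant j _ z) 1) k d).range :=
    fun d x hx ↦ hPerfL d x fun y hy ↦ hx y fun t ht ↦ hy t ht
  have hAdj'' : ∀ (d : ℕ) (y : galoisCohomology ((cd.twist ((W.eisensteinTower κ hm).ρ k)).toLocal (Sum.inr v)) 1)
      (w : galoisCohomology (((W.eisensteinTower κ hm).ρ (k + d)).toLocal (Sum.inr v)) 1),
      incQ' d (((D k).localCup (Sum.inr v)).flip y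
        (Tower.redIter (H := fun j ↦ galoisCohomology (((W.eisensteinTower κ hm).ρ j).toLocal (Sum.inr v)) 1)
          (fun j ↦ ContinuousRep.cohomologyMap (((W.eisensteinTower κ hm).ρ (j + 1)).toLocal (Sum.inr v))
            (((W.eisensteinTower κ hm).ρ j).toLocal (Sum.inr v)) ((W.eisensteinTower κ hm).red j).toAddMonoidHom
            continuous_of_discreteTopology (fun _ z => (W.eisensteinTower κ hm).red_equivariant j _ z) 1) k d w)) =
        ((D (k + d)).localCup (Sum.inr v)).flip
          (galoisCohomology.map (Literature.NumberTheory.EllipticCurves.DiscreteGaloisModule.localMap (Literature.NumberTheory.EllipticCurves.DiscreteGaloisModule.restrictMap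
            ((W.baseChange K).eisensteinTwistTorsionTransfer κ hm (fun j ↦ (W.baseChange K).torsionGaloisModuleReduce p j)
              (W.torsionGaloisModuleReduce_coe (K := K) (p := p)) (k + 1) (k + d + 1)) cd.conj) (Sum.inr v)) 1 y) w :=
    fun d y w ↦ hAdj' d y w
  have hDualX := Tower.mem_levelCondition_top_of_forall_pairing_bot_eq_zero_of_range
    (X := fun j ↦ galoisCohomology ((cd.twist ((W.eisensteinTower κ hm).ρ j)).toLocal (Sum.inr v)) 1)
    (Y := fun j ↦ galoisCohomology (((W.eisensteinTower κ hm).ρ j).toLocal (Sum.inr v)) 1)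
    (Q := fun j ↦ galoisCohomology ((D j).twistOne.toLocal (Sum.inr v)) 2)
    (fun j ↦ ContinuousRep.cohomologyMap ((cd.twist ((W.eisensteinTower κ hm).ρ (j + 1))).toLocal (Sum.inr v))
      ((cd.twist ((W.eisensteinTower κ hm).ρ j)).toLocal (Sum.inr v)) ((W.eisensteinTower κ hm).red j).toAddMonoidHom
      continuous_of_discreteTopology (fun _ z => (W.eisensteinTower κ hm).red_equivariant j _ z) 1)
    (fun j ↦ ContinuousRep.cohomologyMap (((W.eisensteinTower κ hm).ρ (j + 1)).toLocal (Sum.inr v))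
      (((W.eisensteinTower κ hm).ρ j).toLocal (Sum.inr v)) ((W.eisensteinTower κ hm).red j).toAddMonoidHom
      continuous_of_discreteTopology (fun _ z => (W.eisensteinTower κ hm).red_equivariant j _ z) 1)
    (fun j ↦ ((D j).localCup (Sum.inr v)).flip) p k
    (fun d ↦ galoisCohomology.map (Literature.NumberTheory.EllipticCurves.DiscreteGaloisModule.localMap
      (Literature.NumberTheory.EllipticCurves.DiscreteGaloisModule.restrictMap
        ((W.baseChange K).eisensteinTwistTorsionTransfer κ hm (fun j ↦ (W.baseChange K).torsionGaloisModuleReduce p j)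
          (W.torsionGaloisModuleReduce_coe (K := K) (p := p)) (k + 1) (k + d + 1)) cd.conj) (Sum.inr v)) 1)
    incQ' hPerfL' hAdj'' hNondeg'
    (fun d y hy ↦ W.eisensteinTower_ker_map_twist_transfer_le_levelCondition_bot κ hm cd v k d ((AddMonoidHom.mem_ker).2 hy))
  -- the cores: unramified at `v`, transported unramified from `σ•v`
  have hC : ∀ j, ∀ x ∈ unramifiedSubgroup (GaloisRep.toLocal v ((W.eisensteinTower κ hm).ρ j)) 1,
      ∀ y ∈ (unramifiedSubgroup (GaloisRep.toLocal (cd.σ • v) ((W.eisensteinTower κ hm).ρ j)) 1).map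
        (cd.transportH1 ((W.eisensteinTower κ hm).ρ j) v), (D j).localCup (Sum.inr v) x y = 0 := by
    intro j x hx y hy
    obtain ⟨y', hy', rfl⟩ := hy
    exact (D j).localCup_transportH1_eq_zero_of_mem_unramifiedSubgroup (hR j) v hI hx hy'
  -- the torsion descent
  have hdesc := Tower.levelCondition_mem_iff_forall_pairing_eq_zero_of_forall_nsmul_eq_zero
    (X := fun j ↦ galoisCohomology (((W.eisensteinTower κ hm).ρ j).toLocal (Sum.inr v)) 1)
    (Y := fun j ↦ galoisCohomology ((cd.twist ((W.eisensteinTower κ hm).ρ j)).toLocal (Sum.inr v)) 1)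
    (Q := fun j ↦ galoisCohomology ((D j).twistOne.toLocal (Sum.inr v)) 2)
    (fun j ↦ ContinuousRep.cohomologyMap (((W.eisensteinTower κ hm).ρ (j + 1)).toLocal (Sum.inr v))
      (((W.eisensteinTower κ hm).ρ j).toLocal (Sum.inr v)) ((W.eisensteinTower κ hm).red j).toAddMonoidHom
      continuous_of_discreteTopology (fun _ z => (W.eisensteinTower κ hm).red_equivariant j _ z) 1)
    (fun j ↦ ContinuousRep.cohomologyMap ((cd.twist ((W.eisensteinTower κ hm).ρ (j + 1))).toLocal (Sum.inr v))
      ((cd.twist ((W.eisensteinTower κ hm).ρ j)).toLocal (Sum.inr v)) ((W.eisensteinTower κ hm).red j).toAddMonoidHom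
      continuous_of_discreteTopology (fun _ z => (W.eisensteinTower κ hm).red_equivariant j _ z) 1)
    (fun j ↦ ContinuousRep.cohomologyMap ((D (j + 1)).twistOne.toLocal (Sum.inr v)) ((D j).twistOne.toLocal (Sum.inr v))
      (IwasawaAlgebra.EisensteinCoeff.reduce p m (Nat.le_succ (j + 1))).toAddMonoidHom
      continuous_of_discreteTopology (fun _ z => W.reduce_twistOne κ hm cd D j _ z) 2)
    (fun j ↦ (D j).localCup (Sum.inr v)) p
    (fun j ↦ unramifiedSubgroup (GaloisRep.toLocal v ((W.eisensteinTower κ hm).ρ j)) 1)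
    (fun j ↦ (unramifiedSubgroup (GaloisRep.toLocal (cd.σ • v) ((W.eisensteinTower κ hm).ρ j)) 1).map
      (cd.transportH1 ((W.eisensteinTower κ hm).ρ j) v))
    hB hQ hC k hTX hTY hDualY (fun x hx ↦ hDualX x fun y hy ↦ hx y hy)
  -- `F_𝔮(v)` and `Fbar` are the two level conditions
  have h𝓕 : (W.eisensteinTowerTriple κ hm S hpS hbad L hL hLS k).cond (Sum.inr v) =
      Tower.levelCondition (H := fun j ↦ galoisCohomology (((W.eisensteinTower κ hm).ρ j).toLocal (Sum.inr v)) 1)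
        (fun j ↦ ContinuousRep.cohomologyMap (((W.eisensteinTower κ hm).ρ (j + 1)).toLocal (Sum.inr v))
          (((W.eisensteinTower κ hm).ρ j).toLocal (Sum.inr v)) ((W.eisensteinTower κ hm).red j).toAddMonoidHom
          continuous_of_discreteTopology (fun _ z => (W.eisensteinTower κ hm).red_equivariant j _ z) 1) p
        (fun j ↦ unramifiedSubgroup (GaloisRep.toLocal v ((W.eisensteinTower κ hm).ρ j)) 1) k := by
    unfold eisensteinTowerTriple
    rw [eisensteinSelmerTriple_cond, κ.eisensteinSelmerStructure_inr_of_mem_of_not_mem _ _ hm S _ (k + 1) hv hvS]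
    exact W.levelCondition_eisensteinLocalReduce_succ κ hm (Sum.inr v) _ k
  have hFbar : ((W.eisensteinTowerTriple κ hm S hpS hbad L hL hLS k).cond (Sum.inr (cd.σ • v))).map
        (cd.transportH1 ((W.eisensteinTower κ hm).ρ k) v) =
      Tower.levelCondition (H := fun j ↦ galoisCohomology ((cd.twist ((W.eisensteinTower κ hm).ρ j)).toLocal (Sum.inr v)) 1)
        (fun j ↦ ContinuousRep.cohomologyMap ((cd.twist ((W.eisensteinTower κ hm).ρ (j + 1))).toLocal (Sum.inr v))
          ((cd.twist ((W.eisensteinTower κ hm).ρ j)).toLocal (Sum.inr v)) ((W.eisensteinTower κ hm).red j).toAddMonoidHom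
          continuous_of_discreteTopology (fun _ z => (W.eisensteinTower κ hm).red_equivariant j _ z) 1) p
        (fun j ↦ (unramifiedSubgroup (GaloisRep.toLocal (cd.σ • v) ((W.eisensteinTower κ hm).ρ j)) 1).map
          (cd.transportH1 ((W.eisensteinTower κ hm).ρ j) v)) k := by
    rw [W.eisensteinTowerTriple_cond_map_transportH1_eq_of_mem_of_not_mem κ hm S hpS hbad L hL hLS cd k v hσv hσvS]
    haveI := W.subsingleton_galoisCohomology_twist_eisensteinLevel_zero κ hm cd (Sum.inr v)
    rw [Tower.levelCondition_succ_eq_levelCondition_shift _ p _ k]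
    rfl
  -- conclude
  unfold DualityDatum.IsSelfOrthogonalAt
  simp only []
  rw [hFbar, h𝓕]
  exact hdesc

/-! ## §2 The canonical conjugation datum: inertia compatibility automatic, one torsion bound per place -/

/-- **H.4 at a bad place for the CANONICAL conjugation datum `ConjugationDatum.ofLifts σ … τ …`** (inertia compatibility of the
local transport is automatic, `phi_mem_absInertia_iff`), with the uniform torsion given at `v` AND at `σ•v` for the plain towers
(the twisted tower at `v` is the transport of the plain tower at `σ•v`): exactly the shape in which x9-p1-w4's (N1)
`exists_forall_pow_smul_galoisCohomology_one_toLocal_eq_zero_uniform` delivers the bounds (exponents may differ; levels `T^{(j)}`,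
i.e. F_𝔮 levels `j+1`). [cite: Howard2004HeegnerKolyvagin, §1.3 H.4, Def. 3.1.2 and Def. 3.2.6 (arXiv p. 7 L78–82, p. 15–16)]
[cite: MilneADT2006, Ch. I, Cor. 2.3 and Thm. 2.6] -/
theorem eisensteinTower_isSelfOrthogonalAt_of_mem_of_not_mem_ofLifts
    (σ : K ≃ₐ[ℚ] K) (hσ₁ : σ ≠ 1) (hσ : σ * σ = 1) (τ : AlgebraicClosure K ≃+* AlgebraicClosure K)
    (hτl : IsLiftOfAut σ τ) (hτ₂ : Function.Involutive τ)
    (D' : letI := IwasawaAlgebra.isLocalRing_quotient_X_pow_add_C p hm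
      ∀ k, DualityDatum p (ConjugationDatum.ofLifts σ hσ₁ hσ τ hτl hτ₂) ((W.eisensteinTower κ hm).ρ k)
        (IwasawaAlgebra.EisensteinCoeff p m (k + 1)))
    (he_red : letI := IwasawaAlgebra.isLocalRing_quotient_X_pow_add_C p hm
      ∀ k (x y : EisensteinLevel p m (fun j ↦ geomTorsion (W.baseChange K) ((p : ℤ) ^ j)) (k + 1 + 1)),
        IwasawaAlgebra.EisensteinCoeff.reduce p m (Nat.le_succ (k + 1)) ((D' (k + 1)).e x y) =
          (D' k).e ((W.eisensteinTower κ hm).red k x) ((W.eisensteinTower κ hm).red k y))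
    (hPT : poitouTate_selmerStructure_duality K) (k : ℕ)
    {v : HeightOneSpectrum (𝓞 K)} (hv : ((p : ℕ) : 𝓞 K) ∉ v.asIdeal) (hvS : v ∈ S)
    (hσv : ((p : ℕ) : 𝓞 K) ∉ (σ • v).asIdeal) (hσvS : σ • v ∈ S)
    {c₁ c₂ : ℕ}
    (hTX : letI := IwasawaAlgebra.isLocalRing_quotient_X_pow_add_C p hm
      ∀ (j : ℕ) (x : galoisCohomology (((W.eisensteinTower κ hm).ρ j).toLocal (Sum.inr v)) 1), p ^ c₁ • x = 0)
    (hTXσ : letI := IwasawaAlgebra.isLocalRing_quotient_X_pow_add_C p hm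
      ∀ (j : ℕ) (x : galoisCohomology (((W.eisensteinTower κ hm).ρ j).toLocal (Sum.inr (σ • v))) 1), p ^ c₂ • x = 0) :
    letI := IwasawaAlgebra.isLocalRing_quotient_X_pow_add_C p hm
    (D' k).IsSelfOrthogonalAt (W.eisensteinTowerTriple κ hm S hpS hbad L hL hLS k).cond v := by
  letI := IwasawaAlgebra.isLocalRing_quotient_X_pow_add_C p hm
  refine W.eisensteinTower_isSelfOrthogonalAt_of_mem_of_not_mem κ hm S hpS hbad L hL hLS
    (ConjugationDatum.ofLifts σ hσ₁ hσ τ hτl hτ₂) D' he_red hPT k hv hvS hσv hσvS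
    (fun g hg ↦ (ConjugationDatum.phi_mem_absInertia_iff hσ v g).1 hg) (c := max c₁ c₂) (fun j x ↦ ?_) (fun j y ↦ ?_)
  · rw [← Nat.sub_add_cancel (le_max_left c₁ c₂), pow_add, mul_smul, hTX j x, smul_zero]
  · obtain ⟨x, rfl⟩ := (ConjugationDatum.ofLifts σ hσ₁ hσ τ hτl hτ₂).transportH1_surjective ((W.eisensteinTower κ hm).ρ j) v y
    have hx0 : p ^ c₂ • x = 0 := hTXσ j x
    rw [← map_nsmul, ← Nat.sub_add_cancel (le_max_right c₁ c₂), pow_add, mul_smul, hx0, smul_zero, map_zero]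

end WeierstrassCurve

end
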